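import Mathlib
import Summits.ValiantsHypothesis.ValiantsHypothesis.Theses.DivisionGap
import Literature.Barriers.ValiantsHypothesis.MonotoneGap

/-!
# Sketch — crux-ideate `stmt-ValiantsHypothesis-5066` (`ZeroOneTransfer`), round 1, ideator 1

First-lemma signatures and transfer statements (`C⁺`) for three idea cards.  Nothing here is a
skeleton; `sorry` only under first lemmas.  All constants were located with `lean search`.
-/

noncomputable section

namespace Summit.ValiantsHypothesis.ValiantsHypothesis.Cruxes.ZeroOneTransfer.IdeaSketch

open Literature.Computability.AlgebraicComplexity Literature.Barriers.ValiantsHypothesis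
open MvPolynomial
open scoped NNReal

open Summit.ValiantsHypothesis.ValiantsHypothesis.Theses.DivisionGap
  (ZeroOneTransfer StDivisionEasy)

/-- Division complexity in the Hrubeš–Yehudayoff normal form (same as `Disproof.divComplexity`). -/
def divC {σ : Type*} (f : MvPolynomial σ ℝ≥0) : ℕ :=
  sInf {s | ∃ h : MvPolynomial σ ℝ≥0, h ≠ 0 ∧ complexity (f * h) + complexity h = s}

/-! ## Card A — `st-quotient-normal-form` -/

/-- A *positive projection*: every variable goes to a variable or to a nonnegative constant
(Valiant projection over the semiring `ℝ≥0`; compare `IsProjection`). -/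
def IsPosSubst {σ τ : Type*} (e : σ → MvPolynomial τ ℝ≥0) : Prop :=
  ∀ i, (∃ j, e i = X j) ∨ ∃ c : ℝ≥0, e i = C c

/-- First lemma A1 (projection monotonicity): a positive projection that does not kill the
cofactor cannot increase division complexity.  Over `ℝ≥0` no cancellation occurs, so the only
way `aeval e h = 0` is that every monomial of `h` meets a variable sent to `0`; the hypothesis
below excludes that by asking the substituted constants to be nonzero. -/
theorem divC_aeval_le {σ τ : Type*} [Fintype σ] [Fintype τ] [DecidableEq τ]
    (e : σ → MvPolynomial τ ℝ≥0)
    (he : ∀ i, (∃ j, e i = X j) ∨ ∃ c : ℝ≥0, c ≠ 0 ∧ e i = C c)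
    (f : MvPolynomial σ ℝ≥0) :
    divC (aeval e f) ≤ divC f := by
  sorry

/-- First lemma A2 (quotient closure): if `f · a = b` with `a ≠ 0`, then
`divC f ≤ divC a + divC b + 2` (cofactor `H := g_a · h_b` where `a h_a = g_a`, `b h_b = g_b`). -/
theorem divC_le_of_mul_eq {σ : Type*} [Fintype σ] (f a b : MvPolynomial σ ℝ≥0)
    (ha : a ≠ 0) (hab : f * a = b) :
    divC f ≤ divC a + divC b + 2 := by
  sorry

/-- Transfer `C⁺_A` (`ArborescenceSpan`): every 0/1-coefficient `VP_ℂ` family has, for each `n`,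
an ARBORESCENCE MULTIPLE THAT IS A SHORT SUM OF ARBORESCENCE POLYNOMIALS:
`f_n · ST_N(e₀) = Σ_{j<J} ST_N(e_j)` with `N, J` quasi-polynomial in `n` and `e₀, e_j` positive
projections of Jerrum–Snir's directed spanning-tree polynomial `stPoly ℝ≥0 N` ("0/1-VP lies in the
short positive span of the matrix-tree theorem").  Products of ST-projections are ST-projections
(glue the roots), so this class is closed under `×` and short `Σ`; with `StDivisionEasy` (support
item 10463), A1 and A2 it gives `ZeroOneTransfer`. -/
def ArborescenceSpan : Prop :=
  ∀ (σ : ℕ → Type) [∀ n, Fintype (σ n)] (f : ∀ n, MvPolynomial (σ n) ℝ≥0),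
    (∀ n m, coeff m (f n) = 0 ∨ coeff m (f n) = 1) →
    IsVPFamily (k := ℂ) (fun n => map (Complex.ofRealHom.comp NNReal.toRealHom) (f n)) →
    ∃ c : ℕ, ∀ n, ∃ N ≤ 2 ^ ((Nat.log 2 n + c) ^ c), ∃ J ≤ 2 ^ ((Nat.log 2 n + c) ^ c),
      ∃ e₀ : (Fin N × Option (Fin N)) → MvPolynomial (σ n) ℝ≥0,
      ∃ e : Fin J → (Fin N × Option (Fin N)) → MvPolynomial (σ n) ℝ≥0,
        IsPosSubst e₀ ∧ (∀ j, IsPosSubst (e j)) ∧ aeval e₀ (stPoly ℝ≥0 N) ≠ 0 ∧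
        f n * aeval e₀ (stPoly ℝ≥0 N) = ∑ j : Fin J, aeval (e j) (stPoly ℝ≥0 N)

/-- The single-quotient special case `J = 1` (`StQuotientComplete`), kept for the record: it is the
rigid form most likely to die on SUMS (`ST(x) + ST(y)`), which is why `C⁺_A` allows `J` terms. -/
def StQuotientComplete : Prop :=
  ∀ (σ : ℕ → Type) [∀ n, Fintype (σ n)] (f : ∀ n, MvPolynomial (σ n) ℝ≥0),
    (∀ n m, coeff m (f n) = 0 ∨ coeff m (f n) = 1) →
    IsVPFamily (k := ℂ) (fun n => map (Complex.ofRealHom.comp NNReal.toRealHom) (f n)) →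
    ∃ c : ℕ, ∀ n, ∃ N ≤ 2 ^ ((Nat.log 2 n + c) ^ c),
      ∃ e₁ e₂ : (Fin N × Option (Fin N)) → MvPolynomial (σ n) ℝ≥0,
        IsPosSubst e₁ ∧ IsPosSubst e₂ ∧ aeval e₂ (stPoly ℝ≥0 N) ≠ 0 ∧
        f n * aeval e₂ (stPoly ℝ≥0 N) = aeval e₁ (stPoly ℝ≥0 N)

/-- First lemma A3 (sums of arborescence projections are division-easy): the numerator side of
`ArborescenceSpan` is quasi-polynomially division-easy given `StDivisionEasy`
(`a/b + c/d = (ad+bc)/(bd)` on cofactors). -/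
theorem divC_sum_aeval_stPoly_le (hST : StDivisionEasy) :
    ∃ c : ℕ, ∀ (N J : ℕ) (τ : Type) [Fintype τ] [DecidableEq τ]
      (e : Fin J → (Fin N × Option (Fin N)) → MvPolynomial τ ℝ≥0),
      (∀ j i, (∃ v, e j i = X v) ∨ ∃ r : ℝ≥0, r ≠ 0 ∧ e j i = C r) →
      divC (∑ j : Fin J, aeval (e j) (stPoly ℝ≥0 N)) ≤ (J + 1) * (N ^ c + c) + c := by
  sorry

/-! ## Card B — `free-degeneration` (initial forms are free over the semifield) -/

/-- The `w`-initial (top weighted-homogeneous) form of `g`. -/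
def topForm {σ : Type*} (w : σ → ℕ) (g : MvPolynomial σ ℝ≥0) : MvPolynomial σ ℝ≥0 :=
  weightedHomogeneousComponent w (weightedTotalDegree w g) g

/-- First lemma B1: monotone complexity does not increase under passing to an initial form
(gate by gate: keep each gate's top `w`-form; sums of equal weight never cancel over `ℝ≥0`). -/
theorem complexity_topForm_le {σ : Type*} [Fintype σ] (w : σ → ℕ) (g : MvPolynomial σ ℝ≥0) :
    complexity (topForm w g) ≤ complexity g := by
  sorry

/-- First lemma B2: the same for division complexity, because `topForm w (f*h) =
topForm w f * topForm w h` and `topForm w h ≠ 0` for `h ≠ 0` (no zero divisors, no cancellation).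
So the class of division-easy families is closed under ALL toric degenerations. -/
theorem divC_topForm_le {σ : Type*} [Fintype σ] (w : σ → ℕ) (f : MvPolynomial σ ℝ≥0) :
    divC (topForm w f) ≤ divC f := by
  sorry

/-- Transfer `C⁺_B` (`SymbolicPadding`), equivalent to the NONNEGATIVE-coefficient version of the
crux by B2 (the padded family has `t · f_n` as its top `t`-form) and implying `ZeroOneTransfer`:
Hrubeš's `ε`-padding `(1 + Σ xᵢ)^d + ε f` — monotone-easy for every constant `ε ≤ ε₀`
(Hrubeš, ECCC TR19-034 Thm 1) — stays division-easy with `ε` a VARIABLE `t`.  Variables of the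
padded family: `Option (σ n)`, `none` being `t`. -/
def SymbolicPadding : Prop :=
  ∀ (σ : ℕ → Type) [∀ n, Fintype (σ n)] (f : ∀ n, MvPolynomial (σ n) ℝ≥0),
    IsVPFamily (k := ℂ) (fun n => map (Complex.ofRealHom.comp NNReal.toRealHom) (f n)) →
    IsQPBounded fun n =>
      divC ((1 + ∑ i : σ n, (X (some i) : MvPolynomial (Option (σ n)) ℝ≥0)) ^ (f n).totalDegree
        + X none * rename some (f n))

/-- Cheapest falsifier of the crux exposed by B2 (`FaceClosure`, a CONSEQUENCE of the crux):
every initial form of a 0/1 `VP_ℂ` family is itself division-easy, hence (Strassen) in `VQP`.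
A 0/1 `VP` family with a `VNP`-hard face polynomial would therefore refute `ZeroOneTransfer`
outright relative to `VNP ⊄ VQP`. -/
def FaceClosure : Prop :=
  ∀ (σ : ℕ → Type) [∀ n, Fintype (σ n)] (f : ∀ n, MvPolynomial (σ n) ℝ≥0) (w : ∀ n, σ n → ℕ),
    (∀ n m, coeff m (f n) = 0 ∨ coeff m (f n) = 1) →
    IsVPFamily (k := ℂ) (fun n => map (Complex.ofRealHom.comp NNReal.toRealHom) (f n)) →
    IsQPBounded fun n => divC (topForm (w n) (f n))

/-! ## Card C — `structural-monus` (Hrubeš's telescoping as a synchronisation problem) -/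

/-- Gate-wise domination of weighted circuits over `ℝ≥0`: same shape, product gates equal,
sum gates with the same operands and coefficientwise smaller weights. -/
def GateDom {σ : Type*} : ArithCircuit.Gate ℝ≥0 σ → ArithCircuit.Gate ℝ≥0 σ → Prop
  | .sum a, .sum a' => a.map Prod.snd = a'.map Prod.snd ∧
      List.Forall₂ (fun p p' => p'.1 ≤ p.1) a a'
  | .prod u, .prod u' => u = u'
  | _, _ => False

/-- `Dominates P P'`: `P'` is a *structural restriction* of `P` (Hrubeš TR19-034, proof of
Lemma 22: `x_j ⊑ L = Σ xᵢ` at the leaves, everything else equal). -/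
def Dominates {σ : Type*} (P P' : ArithCircuit ℝ≥0 σ) : Prop :=
  P.output = P'.output ∧ List.Forall₂ GateDom P.gates P'.gates

/-- First lemma C1 (structural monus, Hrubeš TR19-034 eq. (4)–(5) made general): the difference of
a circuit and any structural restriction of it is monotone-easy — the telescoping
`D(uw) = D(u)·P(w) + N(u)·D(w)`, `D(u+w) = D(u) + D(w) + (dropped weight)·P`. -/
theorem structuralMonus {σ : Type*} [Fintype σ] {P P' : ArithCircuit ℝ≥0 σ}
    (h2 : P.IsFanInTwo) (hdom : Dominates P P') :
    ∃ D : MvPolynomial σ ℝ≥0, P.eval = P'.eval + D ∧ complexity D ≤ 3 * P.size + 3 := by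
  sorry

/-- Transfer `C⁺_C` (`ScalarShrink`), EQUIVALENT to the crux (⇐ by Hrubeš's Thm 1, which is C1 applied to
`f₋ ⊑ R·(1+Σxᵢ)^d`; ⇒ because scalars are free in `complexity`, so `f = U − R•F` is a 0/1 `VP` instance):
division only ever has to cancel a SCALAR multiple of the universal polynomial — if `U` is monotone-easy and
`U = R • (1 + Σ xᵢ)^d + f` with `f` a 0/1 polynomial, then `f` is division-easy, quasi-polynomially in
`L₊(U)`, `d`, `deg f` and `#vars` (no hypothesis on the size of the real scalar `R`). -/
def ScalarShrink : Prop :=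
  ∃ c : ℕ, ∀ (n d : ℕ) (R : ℝ≥0) (σ : Type) [Fintype σ] (U f : MvPolynomial σ ℝ≥0),
    Fintype.card σ ≤ n → d ≤ n → f.totalDegree ≤ n → complexity U ≤ n →
    (∀ m, coeff m f = 0 ∨ coeff m f = 1) →
    U = R • (1 + ∑ i : σ, (X i : MvPolynomial σ ℝ≥0)) ^ d + f →
    divC f ≤ 2 ^ ((Nat.log 2 n + c) ^ c)

end Summit.ValiantsHypothesis.ValiantsHypothesis.Cruxes.ZeroOneTransfer.IdeaSketch

end
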